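import Summits.AtomisticToContinuum.Crystallization.Theorems.ChartedZeroExcessLayeredLatticeLiouvilleTZM
import Literature.Analysis.PDE.GehringLemma

/-!
# Zero-excess layered lattice Liouville — part UA (lens-2 g42, node «RigidCaccioppoli», (T3)): the route-posited weak reverse Hölder
# inequality [C] `RigidCaccioppoliPG` for the strain of a re-registration, and the counting-measure doubling of door sets (PROVED)

Line `_16XH19(_tol)` of statement 26636, (M)-side, typing order (T3) of critic row 729 (ii).  This file TYPES the route-posited crux
[C] `RigidCaccioppoliPG` (MECHANISM · GSC-priced · UNDECIDED; no literature claim) over the tree's `IsGlobalReg` / `IsTiltStrainData` and the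
finite averages `Literature.Analysis.PDE.finavg` of the Gehring leaf, and PROVES the leaf's measure-theoretic hypothesis for door sets: the
counting measure of a `δ`-separated `aHi`-clean configuration is doubling on atom-centred balls at EVERY scale with constant
`doorDoublingC δ = (40/δ + 1)³` (`ncard_inter_ball_two_mul_le`).  The glue `[C] ∧ Gehring-leaf ⇒ (M♭)₀ ⇒ (M)` is part UB.
-/

noncomputable section

open scoped BigOperators
open MeasureTheory Set Metric Filter Topology
open Summit.AtomisticToContinuum.Crystallization.Theorems.ChartedPlanarOrderRigidityDoor (E3 atomsIn)
open Summit.AtomisticToContinuum.Crystallization.Theorems.ChartedPlanarOrderDensityDichotomy (μS IsSep nK nK_nonneg)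
open Summit.AtomisticToContinuum.Crystallization.Theorems.ChartedPlanarOrderCleanScaleP (IsCleanP IsDoorSetP
  exists_mem_dist_lt_five_of_cleanP)
open Summit.AtomisticToContinuum.Crystallization.Theorems.ChartedPlanarOrderMesoCut (LayeredHom EnvClose)
open Summit.AtomisticToContinuum.Crystallization.Theorems.ChartedPlanarOrderDoorLayered (atomsIn_subset)
open Summit.AtomisticToContinuum.Crystallization.Theorems.ChartedPlanarOrderDoorLayeredOsc (IsTwoShellAffineGood)
open Literature.MathematicalPhysics.StatisticalMechanics (card_le_of_separated_of_dist_le)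
open Literature.Analysis.PDE (finavg ZatorskaGoldstein2005_localGehringLemmaCounting)

namespace Summit.AtomisticToContinuum.Crystallization.Theorems.ChartedZeroExcessLayeredLatticeLiouville

/-! ### YA.1  The route-posited crux [C] «RigidCaccioppoliPG» -/

/-- ★★★ **[C] «RigidCaccioppoliPG aHi Λ θ s» — WEAK REVERSE HÖLDER INEQUALITY FOR THE STRAIN OF A RE-REGISTRATION, ABOVE THE
BACKGROUND LEVEL `η` (route-posited crux; MECHANISM · GSC-priced · UNDECIDED).**  With (M)'s binder prefix (`∀ δ a Cg ∃ Cg' ≥ Cg`, then the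
constants `b > 0`, `0 < d < 1`, `A ≥ 0`, then `∀ K₀ ∃ η₁ R₁`): on every FAT window of a θ-good GSC door set registered by `Ψ` at `(Cg, η, R)` to
an equilibrium `s`-chart there are a re-registration `Ψ'` at `(Cg', η, R)` and tilt–strain data `(Q, σ)` for `Ψ'` on the big window `win (8R)`
with (i) `Σ_{win 8R} σ² ≤ A·η·nK(win 8R)` (L²-background) and (ii) for EVERY atom-centred ball `B(x, r)`, `x ∈ S`, `r > 0`, whose double
`S ∩ ball x (2r)` lies in `ball 0 (8R)`: `⨍_{S ∩ B(x,r)} σ² ≤ b·((⨍_{S ∩ B(x,2r)} (σ²)^d)^{1/d} + A·η)` (finite averages `finavg` of the Gehring leaf).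
Remarks: below scale `ρ₀` (ii) is automatic (`x ∈ 2B`, `ℓ^{2d} ⊂ ℓ²`); the additive floor `A·η` makes (ii) vacuous on balls of at most average
strain, so (ii) only forbids CONCENTRATION of `σ²` above the background at intermediate and large scales — an isolated `O(1)` misfit at `x₀`
violates (ii) on the balls `B(x₀, r)`, `r* ≲ r ≲ η^{-1/3}`.  With the Gehring leaf, (i)+(ii) give `σ² ∈ L^{1+ε}` with mean `O(η)` on
`win (R+1)`, whence (M♭)₀ by Chebyshev (glue, g43).
Why it might fail: a GSC door configuration with sparse, isolated `O(1)` elastic misfits (defect-free strain concentrations at scale `ρ₀`,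
density `≍ η`) would satisfy the registration budgets yet violate (ii) at intermediate scales; the bet is that ground states relax isolated
defect-free strain concentrations (elastic ε-regularity from single-site/compact-perturbation minimality).
Sources (for the shape, not the claim): Caccioppoli–reverse-Hölder route to higher integrability, Giaquinta–Modica 1979 [giaquinta1984 Ch. V
§2]; this tree: `StrainSparsePG`, `IsTiltStrainData`, `IsGlobalReg`; MEMO-g43-M.md §3, FACT-g43-GehringLemma.md §5, NODE-g43-T3-RigidCaccioppoli.md (lens-2 g42). [this file, g42] -/
def RigidCaccioppoliPG (aHi Λ θ s : ℝ) : Prop :=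
  ∀ δ : ℝ, 0 < δ → ∀ a : ℝ, 0 < a → ∀ Cg : ℝ, 1 ≤ Cg → ∃ Cg' : ℝ, Cg ≤ Cg' ∧
    ∃ b : ℝ, 0 < b ∧ ∃ d : ℝ, 0 < d ∧ d < 1 ∧ ∃ A : ℝ, 0 ≤ A ∧
    ∀ K₀ : ℝ, 0 < K₀ → ∃ η₁ : ℝ, 0 < η₁ ∧ ∃ R₁ : ℝ, 0 < R₁ ∧
      ∀ S : Set E3, IsDoorSetPG aHi δ S → (∀ q ∈ S, IsTwoShellAffineGood θ S q) →
        ∀ η : ℝ, 0 < η → η ≤ η₁ → ∀ R : ℝ, R₁ ≤ R →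
          ∀ (L : E3 ≃L[ℝ] E3) (w : ℤ → E3), IsEquilChart a s Λ L w →
            ∀ Ψ : E3 → E3, IsGlobalReg Cg η R S (LayeredHom (L : E3 →L[ℝ] E3) w) Ψ →
              K₀ ≤ η * nK (atomsIn (μS S) 0 R) →
                ∃ Ψ' : E3 → E3, IsGlobalReg Cg' η R S (LayeredHom (L : E3 →L[ℝ] E3) w) Ψ' ∧
                  ∃ (Q : E3 → (E3 ≃ₗᵢ[ℝ] E3)) (σ : E3 → ℝ), IsTiltStrainData S (8 * R) Ψ' Q σ ∧
                    (∑ᶠ x ∈ atomsIn (μS S) 0 (8 * R), σ x ^ 2) ≤ A * η * nK (atomsIn (μS S) 0 (8 * R)) ∧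
                    ∀ x ∈ S, ∀ r : ℝ, 0 < r → S ∩ ball x (2 * r) ⊆ ball 0 (8 * R) →
                      finavg (S ∩ ball x r) (fun y => σ y ^ 2) ≤
                        b * ((finavg (S ∩ ball x (2 * r)) (fun y => (σ y ^ 2) ^ d)) ^ (1 / d) + A * η)

/-! ### YA.2  Counting-measure doubling of door sets (the leaf's `C_D = C_D(δ)`, every scale, atom-centred balls) -/

/-- the doubling constant `(40/δ + 1)³` of the counting measure of a `δ`-separated `5`-dense configuration. -/
def doorDoublingC (δ : ℝ) : ℝ := (40 / δ + 1) ^ 3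

/-- `1 ≤ doorDoublingC`. [formal bookkeeping] -/
theorem one_le_doorDoublingC {δ : ℝ} (hδ : 0 < δ) : 1 ≤ doorDoublingC δ := by
  unfold doorDoublingC
  have h0 : (0 : ℝ) ≤ 40 / δ := by positivity
  have h : (1 : ℝ) ≤ 40 / δ + 1 := by linarith
  exact one_le_pow₀ h

/-- atom-centred (indeed arbitrarily centred) open balls meet a `δ`-separated set finitely. -/
theorem finite_inter_ball_of_isSep {δ : ℝ} (hδ : 0 < δ) {S : Set E3} (hsep : IsSep δ S) (x : E3) (r : ℝ) :
    (S ∩ ball x r).Finite := by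
  have h := Literature.Probability.Process.LocalConfig.finite_inter_of_separated hδ hsep (isCompact_closedBall x r)
  exact h.subset fun p hp => ⟨ball_subset_closedBall hp.2, hp.1⟩

/-- PACKING FROM ABOVE about any centre: `#(S ∩ ball x r) ≤ (2r/δ + 1)³`. -/
theorem ncard_inter_ball_le_packing {δ : ℝ} (hδ : 0 < δ) {S : Set E3} (hsep : IsSep δ S) (x : E3) {r : ℝ} (hr : 0 ≤ r) :
    ((S ∩ ball x r).ncard : ℝ) ≤ (2 * r / δ + 1) ^ 3 := by
  have hW := finite_inter_ball_of_isSep hδ hsep x r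
  have h1 := card_le_of_separated_of_dist_le hW.toFinset x hδ hr
    (fun c hc => (mem_ball.1 (hW.mem_toFinset.1 hc).2).le)
    (fun c hc d hd hcd => hsep c (hW.mem_toFinset.1 hc).1 d (hW.mem_toFinset.1 hd).1 hcd)
  rw [finrank_euclideanSpace_fin] at h1
  rw [Set.ncard_eq_toFinset_card _ hW]
  simpa using h1

/-- VOLUME FROM BELOW about any centre (`5`-relative density of clean configurations): `((r − 5)/5)³ ≤ #(S ∩ ball x r)` for `r > 5`. -/
theorem cube_le_ncard_inter_ball {aHi δ : ℝ} (haHi : aHi ≤ 8 / 7) (hδ : 0 < δ) {S : Set E3} (hsep : IsSep δ S)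
    (hC : IsCleanP aHi (μS S)) (hne : S.Nonempty) (x : E3) {r : ℝ} (hr : 5 < r) :
    ((r - 5) / 5) ^ 3 ≤ ((S ∩ ball x r).ncard : ℝ) := by
  have hF := finite_inter_ball_of_isSep hδ hsep x r
  have hcov : closedBall x (r - 5) ⊆ ⋃ y ∈ hF.toFinset, closedBall y 5 := by
    intro p hp
    obtain ⟨y, hy, hyp⟩ := exists_mem_dist_lt_five_of_cleanP haHi hδ hsep hC hne p
    have hp0 : dist p x ≤ r - 5 := mem_closedBall.1 hp
    have hyF : y ∈ hF.toFinset := by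
      rw [Set.Finite.mem_toFinset]
      refine ⟨hy, mem_ball.2 ?_⟩
      calc dist y x ≤ dist y p + dist p x := dist_triangle y p x
        _ < 5 + (r - 5) := by rw [dist_comm y p]; linarith
        _ = r := by ring
    exact Set.mem_biUnion hyF (mem_closedBall.2 hyp.le)
  have hvol : volume (closedBall x (r - 5)) ≤ ∑ y ∈ hF.toFinset, volume (closedBall y (5 : ℝ)) :=
    (measure_mono hcov).trans (measure_biUnion_finset_le _ _)
  rw [Measure.addHaar_closedBall volume x (by linarith : (0 : ℝ) ≤ r - 5),
    Finset.sum_congr rfl (fun y _ => Measure.addHaar_closedBall volume y (by norm_num : (0 : ℝ) ≤ 5)),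
    Finset.sum_const, nsmul_eq_mul, finrank_euclideanSpace_fin, ← mul_assoc] at hvol
  have hV0 : volume (ball (0 : E3) 1) ≠ 0 := (measure_ball_pos volume (0 : E3) one_pos).ne'
  have hVt : volume (ball (0 : E3) 1) ≠ ⊤ := measure_ball_lt_top.ne
  rw [ENNReal.mul_le_mul_iff_left hV0 hVt, ← ENNReal.ofReal_natCast,
    ← ENNReal.ofReal_mul (by positivity), ENNReal.ofReal_le_ofReal_iff (by positivity)] at hvol
  rw [Set.ncard_eq_toFinset_card _ hF, div_pow, div_le_iff₀ (by positivity)]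
  exact hvol

/-- ★ **COUNTING-MEASURE DOUBLING OF DOOR SETS (PROVED)** — the Gehring leaf's hypothesis: for a `δ`-separated `aHi`-clean nonempty
configuration (`aHi ≤ 8/7`), `#(S ∩ ball x (2r)) ≤ (40/δ + 1)³ · #(S ∩ ball x r)` for every `x ∈ S` and `r > 0`. -/
theorem ncard_inter_ball_two_mul_le {aHi δ : ℝ} (haHi : aHi ≤ 8 / 7) (hδ : 0 < δ) {S : Set E3} (hsep : IsSep δ S)
    (hC : IsCleanP aHi (μS S)) {x : E3} (hx : x ∈ S) {r : ℝ} (hr : 0 < r) :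
    ((S ∩ ball x (2 * r)).ncard : ℝ) ≤ doorDoublingC δ * ((S ∩ ball x r).ncard : ℝ) := by
  have hup := ncard_inter_ball_le_packing hδ hsep x (by linarith : (0 : ℝ) ≤ 2 * r)
  have hone : (1 : ℝ) ≤ ((S ∩ ball x r).ncard : ℝ) := by
    have hfin := finite_inter_ball_of_isSep hδ hsep x r
    have hmem : x ∈ S ∩ ball x r := ⟨hx, mem_ball_self hr⟩
    have hpos : 0 < (S ∩ ball x r).ncard := (Set.ncard_pos hfin).2 ⟨x, hmem⟩
    exact_mod_cast Nat.succ_le_of_lt hpos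
  have h40 : 0 ≤ 40 / δ := by positivity
  by_cases h10 : r ≤ 10
  · -- small balls: the centre alone carries the lower bound
    have h1 : 2 * (2 * r) / δ + 1 ≤ 40 / δ + 1 := by
      have : 2 * (2 * r) / δ ≤ 40 / δ := by
        apply div_le_div_of_nonneg_right _ hδ.le; linarith
      linarith
    have h2 : (2 * (2 * r) / δ + 1) ^ 3 ≤ (40 / δ + 1) ^ 3 :=
      pow_le_pow_left₀ (by positivity) h1 3
    calc ((S ∩ ball x (2 * r)).ncard : ℝ) ≤ (40 / δ + 1) ^ 3 := hup.trans h2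
      _ = doorDoublingC δ * 1 := by unfold doorDoublingC; ring
      _ ≤ doorDoublingC δ * ((S ∩ ball x r).ncard : ℝ) :=
          mul_le_mul_of_nonneg_left hone (by unfold doorDoublingC; positivity)
  · -- large balls: volume from below
    have h10 : 10 < r := not_le.mp h10
    have hlow := cube_le_ncard_inter_ball haHi hδ hsep hC ⟨x, hx⟩ x (by linarith : (5 : ℝ) < r)
    have hr2 : r / 10 ≤ (r - 5) / 5 := by
      rw [div_le_div_iff₀ (by norm_num : (0:ℝ) < 10) (by norm_num : (0:ℝ) < 5)]; linarith
    have hr3 : (r / 10) ^ 3 ≤ ((S ∩ ball x r).ncard : ℝ) := (pow_le_pow_left₀ (by positivity) hr2 3).trans hlow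
    have h1 : 2 * (2 * r) / δ + 1 ≤ (40 / δ + 1) * (r / 10) := by
      have hr10 : 1 ≤ r / 10 := by rw [le_div_iff₀ (by norm_num : (0:ℝ) < 10)]; linarith
      have : 2 * (2 * r) / δ = 40 / δ * (r / 10) := by field_simp; ring
      nlinarith
    calc ((S ∩ ball x (2 * r)).ncard : ℝ) ≤ (2 * (2 * r) / δ + 1) ^ 3 := hup
      _ ≤ ((40 / δ + 1) * (r / 10)) ^ 3 := pow_le_pow_left₀ (by positivity) h1 3
      _ = doorDoublingC δ * (r / 10) ^ 3 := by unfold doorDoublingC; ring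
      _ ≤ doorDoublingC δ * ((S ∩ ball x r).ncard : ℝ) :=
          mul_le_mul_of_nonneg_left hr3 (by unfold doorDoublingC; positivity)

/-- tilt–strain data on a bigger window are tilt–strain data on the smaller one. -/
theorem isTiltStrainData_of_radius_le {S : Set E3} {R R' : ℝ} (h : R ≤ R') {Ψ : E3 → E3} {Q : E3 → (E3 ≃ₗᵢ[ℝ] E3)}
    {σ : E3 → ℝ} (hd : IsTiltStrainData S R' Ψ Q σ) : IsTiltStrainData S R Ψ Q σ :=
  ⟨hd.1, hd.2.1, fun x hx p hp hpx => hd.2.2 x (atomsIn_mono_radius h hx) p hp hpx⟩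

end Summit.AtomisticToContinuum.Crystallization.Theorems.ChartedZeroExcessLayeredLatticeLiouville

end
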